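import Literature.MathematicalPhysics.QuantumFieldTheory.Balaban1983to89.B9Cor36GDirKnitAtCutField
import Literature.MathematicalPhysics.QuantumFieldTheory.Balaban1983to89.B9Prop26DirichletBondReadingRight
import Literature.MathematicalPhysics.QuantumFieldTheory.Balaban1983to89.B9Cor36GDirCutWindowsThree
import Literature.MathematicalPhysics.QuantumFieldTheory.Balaban1983to89.B9Cor36GVKDivForm

/-!
# `Balaban1983to89.B9Cor36GDirKnitGVDivFormAtCutField` — [Balaban1985BackgroundPropagators] COROLLARY 3.6 p. 408 FOR THE DIRICHLET BOND LETTER OF RECORD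
# `G_□(U) = GDirCKY i □ (DP_□D*) (bondsOverY Ω₀(□)) U` (p. 409 l. 1–5) AT THE SHARP-CUT SMALL FIELD `Ṽ = cutCfgS i T η A`: THE LEFT COMPOSITE
# `G_□(1)·V_□(Ṽ) ≺ κ_D·α₁·e^{−ρ_D d}` OF THE COMPRESSED PERTURBATION WORD `V_□(Ṽ) = 𝟙_B(T(1) − T(Ṽ))𝟙_B` WITH `G_□(1)` ON THE LEFT — r06's `hGV` slot of the
# (3.86) right-entry engine ✓`gExt_rightEntry_of_386L`, PROVED from the GRADIENT form of the word at def-Y's letters, the lattice Leibniz rule, G-F8a's first-order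
# commutators at R2's radius-3 windows, and Theorem 3.3's right entry at `U = 1` taken BY NAME at the right-entry family (R1) — the Dirichlet twin of p38's
# ✓`B9Cor36GVKDivForm.cor36_GK_mul_VK_at_locCfg` (seat dag-n06-c g36, FILE R3 = layer L-DIV of «E2 BY NAME»; cell GAPS G-B9-02)

statement-level skeleton of published theorems with citation tags; proofs where landed; nothing here is a claim about the Yang–Mills mass gap

CITATION HEADER (lean-in-tree rule).  B9 = T. Bałaban, *Propagators for lattice gauge theories in a background field*, Commun. Math. Phys. **99** (1985)
389–434 [Balaban1985BackgroundPropagators] (held `paper:balaban1985-cmp99-background-propagators`; journal page = PDF page + 388): p. 407 (3.82)–(3.86) («V(A) =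
Δ_a(U) − Δ_a(U′U) … The operator V₃(A) is a local differential operator of the first order satisfying the bound (3.73). The operator P₁(A) … is a non-local
bounded operator … G(U′U) = G(U) + G(U′U)V(A)G(U) (3.86). This way we get all these inequalities for the operator G(U′U)»); p. 398 l. 20–24 («we may always
replace ∇_U by ∇*_U, and vice versa, in arbitrary place and combination … Using Lemma 2.1 in [4] we may replace the factor (Lʲη)^α by (Lʲη)^β(L^{j′}η)^γ»);
(3.73) p. 405; (3.37) p. 396; Cor. 3.6 p. 408 l. 1–14 (the cube road, `U = 1`, `α₁ = O(1)Mα₀`); Thm 3.3 p. 399 + (3.42) p. 397 (third entry); Cor. 3.5 p. 407;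
p. 409 l. 1–5 («G_□(U)»).  [4] = [Balaban1984PropagatorsII] Lemma 2.1 (2.61) p. 234, (2.51)–(2.55) p. 232, Prop. 2.6 (2.136)₃ p. 247, p. 248 l. 4–5.
Rows B9.Cor3.6 × B9.Eq3.86 × B9.Eq3.73 × B6.Prop2.6 (cells only; no row head changes).

WHY THIS FILE (cell `pub-ymgap`, node N06 [B9]; road (B5); heads «KE₂₁X-C» ✓p836416 ∕ «KESC-CO» ✓p836424 display the flat right half `hRflA`).  The right entry
`G_□(Ṽ)·∇*_ν` comes from the LEFT-resolvent form of (3.86) times `∇*_ν` — `G(Ṽ)∇* = G(1)∇* + (G(1)V)·(G(Ṽ)∇*)` — whose small letter is `G(1)·V` with `G(1)` on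
the LEFT of the gradient-form word `V = Z + Σ_μ W_μ∇_μ` (F4's compressed split: `Z = (V⁰ + P⁰) + 𝟙D(𝒫_□(Ṽ) − 𝒫_□(1))D*𝟙 + (knit averaging piece)`,
`W_μ = V¹_μ + P¹_μ`).  The far-right `∇_μ` is moved onto `G(1)` by the lattice Leibniz rule (p38 ✓`hasMajorant_GV_of_gradForm_comm_dirs`), at the price of the
commutators `[W_μ, ∇_μ]` (R2 ✓`hasMajorant_commV1Y_cutCfgS` ∕ ✓`hasMajorant_commP1Y_cutCfgS`) and of Theorem 3.3's product entry `G(1)∇_μ = −(G(1)∇*_μ)σ_μ`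
(p38 ✓`hasMajorant_mul_DK_of_DsK`), i.e. of the RIGHT entry `G_□(1)∇*_μ` at `U = 1` — for the Dirichlet letter the named printed fact [4] Prop. 2.6 (2.136)₃ for
`G(Ω)` read at the right-entry family (R1 ✓`thm33_GiK_knit_right_of_prop26DirichletR`, hypothesis `h26R`).  NO mixed entry `∇G∇*` is used.  THIS FILE proves
the `hGV` letter at the Dirichlet bond letter of record under F4's ✓`gDir_knit_at_cutFieldU` binder list VERBATIM (α₀-uniform edition; `h26 ↦ h26R`).

WHAT IS PROVED (0 `def`s; theorems; 0 sorry; 0 new named facts; standard axioms): §1 `GiK_mul_VdK_eq_of_splitC` (the algebra `G(1)·V = (G(1)·pieces)·𝟙♯`);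
§2 ★★★`gDir_knit_GiK_mul_VdK_at_cutFieldU`: there are `ρ_D > 0`, `κ_D ≥ 0`, thresholds `M_D, T_D, N_D`, `a_D > 0` (functions of `d, L, N, b₀, b₁, M₂, ϱ′` and the named
fact's constants) such that for every member above the thresholds, every auxiliary `α₀` of the knit legs, every cover cube, `Rr, H`, bond socket `K_B`, cut set
`T ⊇ Ω₀(□)` and datum `(A; Q, C, ξ, Λ)` with F4's displayed numerics (`2CΛ² ≤ a_D`, …) and bi-contractive `Ṽ`:
`GiK b i (TKnitCY i □ 1) B · VdK b i (TKnitCY i □) B Ṽ ≺ κ_D·(2CΛ²)·e^{−ρ_D d(a,a′)}` over `(toB6 (geoCK i □) Rr H, blkBK i □)`.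

HOW (p. 407 l. 8–17 on Cor. 3.6's cube road; p38's proof transplanted).  Rates: `δ = min(δ₃, δ_P)` (R1's named rate, ROAD (I)'s (3.77) rate), `δ₁ = δ∕2` (all letters),
`ρ_D = δ₂ = δ∕4`; ONE [4] (2.61) datum at `(δ₂, 9∕5000)` (✓`exists_h261_geoCK`) and the inverse-power scale transfers at `δ₂` (✓`hST_geoCK`, `Λ = L⁴`).  Letters at
`Ṽ`, rate `δ₁`: `V⁰, V¹_μ, P⁰, P¹_μ` (✓`hasMajorant_V0Y∕V1Y∕P0Y∕P1Y` at F3's windows), the compressed projection word (ROAD (I) ✓`cdir_pdir_cube_at_field` + F2b's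
congruence), dag-n06-j's knit averaging piece (✓`hasMajorant_avgPieceCKnit` at `Ã`, F3 ✓`ha_cut`), the commutators (R2, threshold `3 < RM1`); `G_□(1) ≺ B₀(Lⁿη)²e^{−δ₁d}`
and `G_□(1)∇*_μ` (R1, `h26R`), `G_□(1)∇_μ` (p38 §2); F4's compressed split (✓`dirB_split_CK`, ✓`projPieceDirK_eq_firstOrder_add_projWord`, ✓`splitC_of_split_of_congr`);
p38 §1 ⟹ `G_□(1)·(Z + Σ_μW_μ∇_μ) ≺ κ_R·α_T·e^{−δ₂d}`, `α_T = alphaW(α₁)L² ≤ 60L²α₁`; §1 puts the right compression `𝟙♯` back for free (F2a ✓`hasMajorant_mul_projK`).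

HONEST SCOPE ∕ NOT CLAIMED.  Assembly over landed modules; CONDITIONAL BY NAME on [4] Prop. 2.6 for `G(Ω)` read with its third entry (`h26R`, R1); DISPLAYED exactly as
in F4: the bond socket `hKB` (✓`exists_bondSocket` inhabits it), the cut set and datum, the x-free numerics of the knit engine, the bi-contractivity `hU`, member
thresholds.  NOT here: the fixed point and the right entry themselves (R4), the member-level bundle (R5).  Nothing on `d = 4`, the continuum, reflection positivity or the
mass gap; NOT a node discharge; count-neutral; no row head changes.  NEW file; nothing landed is modified.  `--supports stmt-QuantumFields-27239`.

RELATED IN THE TREE, NOT DUPLICATED (searched 2026-08-31: `rg 'GiK_mul_VdK|gDir_knit_GiK_mul'` over `Literature/` + `Summits/` = ∅): p38 ✓`B9Cor36GVKDivForm` (the torus twin and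
the abstract engines; USED), F4 ✓`B9Cor36GDirKnitAtCutField` (left composite `V·G(1)` via F2a; its slot derivations are repeated here for `G(1)·V`), R1, R2, F2a∕F2b∕F3,
ROAD (I) ✓`B9Cor36CDirPDirAtField`, dag-n06-j ✓`B9Cor35GDirKnitAvgPieceMajorant` (all USED BY NAME).
-/

noncomputable section

namespace Literature.MathematicalPhysics.QuantumFieldTheory.Balaban1983to89.B9Cor36GDirKnitGVDivFormAtCutField

open NormedSpace Complex
open B6RandomWalk (HasMajorant hasMajorant_mono hasMajorant_add Ineq261 c1_nonneg)
open B9Thm34Ext (toB6)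
open B9Eq352DivFormLetters (conj)
open B9Eq39Adjoint (fluct covD)
open B6KLevelCensusIndexV1 (KIdx kGeo)
open B6Cover236MultiLevelBlocks (cubes)
open B6GlobalChartV1 (PV boxEquiv)
open B9BackgroundsKLevelV1 (shiftsV1)
open B9Eq360DeltaPrimeAY (AfldY)
open B9Eq337CutFieldDirY (cutFldS cutCfgS UboxY_cutCfgS)
open B9CubeLettersOpsL0 (cubeFamY levCubeY)
open B9CubeLettersBondOpsL0 (BlkCubeY)
open B9CubeGeometryInputs (geoCK geoCK_len_pos geoCK_eta geoCK_eta_pos geoCK_dist_axioms RM1 N1 exists_h261_geoCK hST_geoCK geoCK_site_nonempty)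
open B9Cor35GCubeInputsAtOne (blkBK DK LapK)
open B9Cor35GAtCubeLetters (lapPieceK)
open B9Cor35GDirInputsAtOne (GiK mDirC geoDirBI domDirBI admDirBI)
open B9Cor35GDirGStep (VdK projK)
open B9Cor35GDirAtCubeLetters (projPieceDirK VdK_eq_projK_mul GiK_mul_projK)
open B9Cor35GDirAtKnitCubeLetters (avgPieceCKnit dirB_split_CK)
open B9Cor35GDirKnitInputsAtOne (TKnitCY TKnitCY_apply)
open B9Cor35GDirGStepCompressed (hasMajorant_mul_projK hasMajorant_projK_mul_mul_projK)
open B9Eq376ProjPieceDirDictY (projPieceDirK_eq_firstOrder_add_projWord)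
open B9Eq376ProjWordDirCompressedCongr (projK_projWordDir_projK_congr_of_inside splitC_of_split_of_congr)
open B9Eq371CoCurlLeibnizY (V0Y V1Y conj_hessY_one_sub_hessY_eq)
open B9Ineq373HessianPieceBoundsY (dSite cV0 cV1 hasMajorant_V0Y hasMajorant_V1Y)
open B9Eq375GradDivSplitY (P0Y P1Y)
open B9Ineq375GradDivBoundsY (cP0 cP1 hasMajorant_P0Y hasMajorant_P1Y)
open B9Cor36GCubeWindows (alphaW alphaW_nonneg)
open B9Cor36GCubeAtLocCfg (self_le_alphaW alphaW_le_sixty_mul kernel_const_mono)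
open B9Cor35CinvAtCubeLetters (kernel_rate_mono)
open B9Cor36GDirCutWindows (hW1_cut hW2_cut hW3_cut ha_cut)
open B9Cor36CDirPDirAtField (cdir_pdir_cube_at_field)
open B9Cor35GDirKnitAvgPieceMajorant (kappaAvKnit kappaAvKnit_nonneg hasMajorant_avgPieceCKnit)
open B9Cor36GDirKnitAtCutField (kappaAvKnit_mono)
open B9Cor35GpDirInputsAtOne (dirDomY)
open B9C2FormBoxRegimeY (Kpl)
open B7Prop5CplxLevels (epsCplx tauCplx)
open B7Prop2Explicit (C0 c2')
open B7Prop3Flat (c3)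
open B9Prop26DirichletBondReadingRight (GDirBFamR thm33_GiK_knit_right_of_prop26DirichletR)
open B9Cor36GDirCutWindowsThree (hasMajorant_commV1Y_cutCfgS hasMajorant_commP1Y_cutCfgS)
open B9Ineq373FirstOrderCommY (cK1)
open B9Ineq366CPrime (hasMajorant_rate_mono)
open B9Thm33CubeAtOneRight (DsK)
open B9Cor36GVKDivForm (hasMajorant_GV_of_gradForm_comm_dirs hasMajorant_mul_DK_of_DsK add_mul_sub_mul_add)
open Node00 (SiteY FBondY CfgY toKT shiftY UboxY gradY divY)
open Node00.OpsYCubeProjectionG (PDirCubeY)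
open Node00.OpsYCubeDirInverseBond (bondsOverY)
open scoped Matrix Matrix.Norms.L2Operator

variable {d ℓ : ℕ} {hd : 1 ≤ d + 1} {hL : Odd (ℓ + 1) ∧ 1 < ℓ + 1} {b₀ b₁ : ℝ}

/-! ## §1  The algebra: `G(1)·V = (G(1)·pieces)·𝟙♯` from a compressed split -/

section Algebra

variable {𝔸 : Type} [NormedRing 𝔸] [NormedAlgebra ℂ 𝔸] [CompleteSpace 𝔸]
variable {ι : Type} [Fintype ι] (b : Module.Basis ι ℝ 𝔸)
variable (i : KIdx d ℓ hd hL b₀ b₁)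
variable {T : CfgY 𝔸 i → ((FBondY i → 𝔸) →ₗ[ℂ] (FBondY i → 𝔸))} {B : Finset (FBondY i)}

/-- ★ **THE LEFT COMPOSITE FROM A COMPRESSED SPLIT**: if `𝟙♯·conj b((T(1) − T(Ṽ))♯)·𝟙♯ = 𝟙♯·R·𝟙♯`, then `GiK(1)·V = (GiK(1)·R)·𝟙♯` (`V = 𝟙♯·conj b(…)·𝟙♯`,
`GiK·𝟙♯ = GiK`) — the mirror image of F2a's ✓`VdK_mul_GiK_eq_of_splitC`. [cite: Balaban1985BackgroundPropagators, (3.84)–(3.86) p.407, p.394, bookkeeping] -/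
theorem GiK_mul_VdK_eq_of_splitC (V : CfgY 𝔸 i) {R : Module.End ℝ (FBondY i × ι → ℝ)}
    (hsplitC : projK b i B * conj b ((T (fun _ _ => 1) - T V).restrictScalars ℝ) * projK b i B = projK b i B * R * projK b i B) :
    GiK b i (T (fun _ _ => 1)) B * VdK b i T B V = GiK b i (T (fun _ _ => 1)) B * R * projK b i B := by
  rw [VdK_eq_projK_mul, hsplitC, ← mul_assoc, ← mul_assoc, GiK_mul_projK]

end Algebra

/-! ## §2  ★★★ The left composite `G_□(1)·V_□(Ṽ) ≺ κ_D·α₁·e^{−ρ_D d}` at the Dirichlet bond letter of record and the sharp-cut field -/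

section Main

variable {N : ℕ} [Nonempty (Fin N)]
variable {ι : Type} [Fintype ι] [DecidableEq ι] (b : Module.Basis ι ℝ (Matrix (Fin N) (Fin N) ℂ))

set_option maxHeartbeats 4000000 in
/-- ★★★ **COROLLARY 3.6'S SMALL LETTER FOR THE RIGHT ENTRY OF THE DIRICHLET BOND LETTER OF RECORD: `G_□(1)·V_□(Ṽ) ≺ κ_D·(2CΛ²)·e^{−ρ_D·d}` AT THE SHARP-CUT FIELD
`Ṽ = cutCfgS i T η A`, UNIFORMLY IN THE MEMBER, THE AUXILIARY `α₀` AND THE COVER CUBE — CONDITIONAL BY NAME ON [4] PROP. 2.6 FOR `G(Ω)` READ WITH ITS THIRD ENTRY**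
(r06's `hGV` slot of ✓`gExt_rightEntry_of_386L` at the letters `GU := GiK b i (TKnitCY i □ 1) B`, `V := VdK b i (TKnitCY i □) B Ṽ`; F4's ✓`gDir_knit_at_cutFieldU`
binder list VERBATIM). [cite: Balaban1985BackgroundPropagators, Cor. 3.6 p.408, (3.82)–(3.86) p.407, (3.69)–(3.77) pp.404–406, (3.73) p.405, (3.37) p.396, Thm 3.3 p.399, (3.42) p.397, p.398 l.20–24, Cor. 3.5 p.407, p.409 l.1–5; Balaban1984PropagatorsII, Lemma 2.1 (2.61) p.234, (2.51)–(2.55) p.232, Prop. 2.6 (2.136)₃ p.247, p.248 l.4–5] -/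
theorem gDir_knit_GiK_mul_VdK_at_cutFieldU
    (h26R : B6.Prop26DirichletPrinted (geoDirBI (d := d) (ℓ := ℓ) (hd := hd) (hL := hL) (b₀ := b₀) (b₁ := b₁)) domDirBI admDirBI GDirBFamR)
    (hℓ : 1 ≤ ℓ) (hb₀ : 0 < b₀) (hb₁ : b₀ ≤ b₁) (M₂ : ℝ) (hM₂ : 0 ≤ M₂) (hrepr : ∀ (v : Matrix (Fin N) (Fin N) ℂ) (j : ι), |b.repr v j| ≤ M₂ * ‖v‖)
    {α₀' ϱ' ϱ : ℝ} (hα' : 0 < α₀') (hα3 : C0 (d + 1) * α₀' ≤ 1 / 3) (hα8 : 8 * α₀' ≤ c2' (d + 1) (ℓ + 1))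
    (hϱ' : 0 < ϱ') (hϱ : 0 < ϱ)
    (hsmall' : Real.exp (4 * (800 * (((d + 1 : ℕ) : ℝ) + 1) ^ 2 * (((d + 1 : ℕ) : ℝ) + 4)) * α₀') * (1 + 8 * (131072 * (((d + 1 : ℕ) : ℝ) + 1) ^ 2) * ϱ') ≤ 2)
    (hc₃' : 2 * ϱ' ≤ c3 (d + 1) (ℓ + 1)) (hϱ'1 : 409600 * (((d + 1 : ℕ) : ℝ) + 1) ^ 2 * ϱ' ≤ 1)
    (hE : epsCplx (d + 1) (ℓ + 1) ϱ' 0 ≤ 1 / 16)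
    (hdX : ((d + 1 : ℕ) : ℝ) * (epsCplx (d + 1) (ℓ + 1) ϱ' 0 + tauCplx (d + 1) (ℓ + 1) α₀' 0 ϱ' 0) ≤ 1 / 16)
    (hsmallJ : Real.exp (4480 * (((d + 1 : ℕ) : ℝ) + 1) ^ 2 * (((d + 1 : ℕ) : ℝ) + 4) * α₀' + 240000 * (((d + 1 : ℕ) : ℝ) + 1) ^ 3 * ϱ') *
      (1 + 8 * (2097152 * (((d + 1 : ℕ) : ℝ) + 1) ^ 2) * ϱ) ≤ 2)
    (hc₃J : 2 * ϱ ≤ c3 (d + 1) (ℓ + 1) / 4) :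
    ∃ ρD κD MD TD : ℝ, ∃ ND : ℕ, 0 < ρD ∧ 0 ≤ κD ∧ ∃ aD : ℝ, 0 < aD ∧
    ∀ (i : KIdx d ℓ hd hL b₀ b₁) (c : ↥(cubes (toKT i).D.toDomains)) (Rr : ℝ) (H : Prop),
      MD ≤ ((ℓ : ℝ) + 1) * (toKT i).Mh → ND + 1 ≤ (toKT i).R * ((ℓ + 1) * (toKT i).Mh) → TD ≤ RM1 i →
    ∀ α₀ : ℝ, 0 < α₀ → 0 ≤ (kGeo i).M * α₀ → Kpl i ((kGeo i).M * α₀) * (kGeo i).L ^ 4 < α₀' →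
    ∀ (KB : Matrix (FBondY i) (FBondY i) ℝ),
      (mDirC i c).submatrix (fun v : ↥(bondsOverY i (dirDomY i c)) => (v : FBondY i)) (fun v : ↥(bondsOverY i (dirDomY i c)) => (v : FBondY i)) *
        KB.submatrix (fun v : ↥(bondsOverY i (dirDomY i c)) => (v : FBondY i)) (fun v : ↥(bondsOverY i (dirDomY i c)) => (v : FBondY i)) = 1 →
    ∀ (T : Finset (SiteY i)) (A : AfldY (Matrix (Fin N) (Fin N) ℂ) i) (Q : Set (Site (PV d ℓ i.m i.K hd hL) 0)) (C ξ Λ : ℝ),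
      0 ≤ C → (kGeo i).eta ≤ ξ → 1 ≤ Λ → LatticeNorms.scaleLen ((ℓ : ℝ) + 1) (kGeo i).eta (c.1.1 + 1) ≤ Λ * ξ →
      (∀ z ∈ dirDomY i c, z ∈ T) → (∀ z ∈ T, (boxEquiv i.hN).symm z ∈ Q) →
      (∀ κ, ∀ x ∈ Q, ‖A κ x‖ ≤ C * ξ⁻¹) →
      (∀ μ ν, ∀ x ∈ Q, ‖(((kGeo i).eta : ℂ)⁻¹) • covD (shiftsV1 (PV d ℓ i.m i.K hd hL)) (fun _ _ => (1 : (Matrix (Fin N) (Fin N) ℂ)ˣ)) μ (A ν) x‖ ≤ C * (ξ ^ 2)⁻¹) →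
      (∀ z : SiteY i, 1 ≤ levCubeY i c z → z ∈ dirDomY i c ∧ ∀ μ, shiftY i μ z ∈ dirDomY i c ∧ (shiftY i μ).symm z ∈ dirDomY i c ∧
        ∀ ν, shiftY i ν (shiftY i μ z) ∈ dirDomY i c ∧ shiftY i ν ((shiftY i μ).symm z) ∈ dirDomY i c ∧ (shiftY i ν).symm ((shiftY i μ).symm z) ∈ dirDomY i c) →
      2 * C * Λ ^ 2 ≤ aD → 3 * (2 * C * Λ ^ 2) ≤ ϱ' →
      4 * α₀' ≤ c2' (d + 1) (ℓ + 1) →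
      Real.exp (4 * (800 * (((d + 1 : ℕ) : ℝ) + 1) ^ 2 * (((d + 1 : ℕ) : ℝ) + 4)) * α₀') * (1 + 8 * (131072 * (((d + 1 : ℕ) : ℝ) + 1) ^ 2) * (2 * C * Λ ^ 2)) ≤ 2 →
      2 * (2 * C * Λ ^ 2) ≤ c3 (d + 1) (ℓ + 1) → 4096 * ((d + 1 : ℕ) : ℝ) * (2 * C * Λ ^ 2) ≤ 1 →
      (∀ μ x, ‖(cutCfgS i T (kGeo i).eta A μ x : Matrix (Fin N) (Fin N) ℂ)‖ ≤ 1 ∧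
        ‖(((cutCfgS i T (kGeo i).eta A μ x)⁻¹ : (Matrix (Fin N) (Fin N) ℂ)ˣ) : Matrix (Fin N) (Fin N) ℂ)‖ ≤ 1) →
      HasMajorant (g := toB6 (geoCK i c) Rr H) (blkBK i c)
        (GiK b i (TKnitCY i c (fun _ _ => 1)) (bondsOverY i (dirDomY i c)) * VdK b i (TKnitCY i c) (bondsOverY i (dirDomY i c)) (cutCfgS i T (kGeo i).eta A))
        (fun a a' => κD * (2 * C * Λ ^ 2) * Real.exp (-(ρD * (geoCK i c).dist a a'))) := by
  classical
  have hSb : 0 ≤ ∑ j, ‖b j‖ := Finset.sum_nonneg fun j _ => norm_nonneg _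
  have hMS : 0 ≤ M₂ * ∑ j, ‖b j‖ := mul_nonneg hM₂ hSb
  have hL1 : (1 : ℝ) ≤ (ℓ : ℝ) + 1 := by linarith [(Nat.cast_nonneg ℓ : (0 : ℝ) ≤ ℓ)]
  have hb₁0 : 0 ≤ b₁ := hb₀.le.trans hb₁
  -- R1: Theorem 3.3 at `U = 1` for the letter of record WITH the right entry, conditional by name (rate `δ₃`, constant `AR`, threshold `M₁`)
  obtain ⟨M₁, δ₃, AR, hM₁, hδ₃, hAR, h33⟩ := thm33_GiK_knit_right_of_prop26DirichletR (N := N) b h26R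
  -- ROAD (I): the Dirichlet `C_□ ∕ 𝒫_□` package at the field cut AT `Ω₀(□)` (its (3.77) half is the `PP`-slot)
  obtain ⟨δC, δP, BC, K, MP, TP, NP, hδC, hδP, hBC, hK, aP, haP, HCP⟩ := cdir_pdir_cube_at_field b d ℓ hℓ M₂ hM₂ hrepr
  -- one rate below both, its half (the letters) and its quarter (the output)
  set δ : ℝ := min δ₃ δP with hδdef
  have hδ : 0 < δ := lt_min hδ₃ hδP
  have hδG' : δ ≤ δ₃ := min_le_left _ _
  have hδP' : δ ≤ δP := min_le_right _ _
  set δ₁ : ℝ := δ / 2 with hδ₁def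
  set δ₂ : ℝ := δ / 4 with hδ₂def
  have hδ₁ : 0 < δ₁ := by positivity
  have hδ₂ : 0 < δ₂ := by positivity
  have hδ₁δ : δ₁ ≤ δ := by rw [hδ₁def]; linarith only [hδ.le]
  -- (2.61) at `(δ₂, 9∕5000)`
  obtain ⟨dB, h261⟩ := exists_h261_geoCK d ℓ hδ₂
  have hc1 : 0 ≤ B6.c1 dB δ₂ (9 / 5000) := c1_nonneg _ _ _
  -- the constants
  set Λ4 : ℝ := ((ℓ : ℝ) + 1) ^ 4 with hΛ4def
  have hΛ4 : 0 ≤ Λ4 := by positivity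
  set cV : ℝ := (M₂ * ∑ j, ‖b j‖) * max (cV0 d) (cV1 d) * Real.exp (2 * δ₁) with hcVdef
  set cP : ℝ := (M₂ * ∑ j, ‖b j‖) * max (cP0 d) (cP1 d) * Real.exp (2 * δ₁) with hcPdef
  set κ₂ : ℝ := (M₂ * ∑ j, ‖b j‖) * kappaAvKnit d ℓ N b₁ ϱ' 1 δ₁ with hκ₂def
  set cKc : ℝ := (M₂ * ∑ j, ‖b j‖) * ((cK1 d + cP1 d) * Real.exp (3 * δ₁)) with hcKcdef
  have hcV00 : 0 ≤ cV0 d := by unfold cV0; positivity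
  have hcP00 : 0 ≤ cP0 d := by unfold cP0; positivity
  have hcK10 : 0 ≤ cK1 d := by unfold cK1; positivity
  have hcP10 : 0 ≤ cP1 d := by unfold cP1; positivity
  have hcV : 0 ≤ cV := by rw [hcVdef]; exact mul_nonneg (mul_nonneg hMS (le_max_of_le_left hcV00)) (Real.exp_pos _).le
  have hcP : 0 ≤ cP := by rw [hcPdef]; exact mul_nonneg (mul_nonneg hMS (le_max_of_le_left hcP00)) (Real.exp_pos _).le
  have hκ₂ : 0 ≤ κ₂ := by rw [hκ₂def]; exact mul_nonneg hMS (kappaAvKnit_nonneg hb₁0 hϱ' zero_le_one)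
  have hcKc : 0 ≤ cKc := by rw [hcKcdef]; positivity
  set B₀ : ℝ := AR + AR * Real.exp δ₁ * B6.c1 dB δ₂ (9 / 5000) with hB₀def
  have hB₀ : 0 ≤ B₀ := by rw [hB₀def]; positivity
  have hARB : AR ≤ B₀ := by rw [hB₀def]; exact le_add_of_nonneg_right (by positivity)
  have hAEB : AR * Real.exp δ₁ * B6.c1 dB δ₂ (9 / 5000) ≤ B₀ := by rw [hB₀def]; exact le_add_of_nonneg_left hAR.le
  set cZ : ℝ := cV + cP + K + κ₂ with hcZdef
  have hcZ : 0 ≤ cZ := by rw [hcZdef]; positivity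
  set κR : ℝ := B₀ * Λ4 * B6.c1 dB δ₂ (9 / 5000) * (cZ + ((d : ℝ) + 1) * ((cV + cP) + cKc)) with hκRdef
  have hκR : 0 ≤ κR := by rw [hκRdef]; positivity
  -- the size threshold on `α₁ = 2CΛ²` and the output data
  set aD : ℝ := min aP (1 / (120 * ((ℓ : ℝ) + 1) ^ 2)) with haDdef
  have haD : 0 < aD := lt_min haP (by positivity)
  refine ⟨δ₂, 60 * ((ℓ : ℝ) + 1) ^ 2 * κR, max MP M₁, max TP (max (4 * Real.log ((ℓ : ℝ) + 1) / (9 / 5000 * δ₂)) 4), max NP (N1 d ℓ (9 / 5000 * δ₂)), hδ₂,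
    by positivity, aD, haD, ?_⟩
  intro i c Rr H hM hN hT α₀ hα₀ hMα hKpl KB hKB T A Q C ξ Λ hC hξ hΛ hΛξ hTS hQT hA hdA hS2 hα₁a hα₁ϱ hα4' hsmall hc₃ hsm hU
  -- thresholds
  have hMP : MP ≤ ((ℓ : ℝ) + 1) * (toKT i).Mh := (le_max_left _ _).trans hM
  have hMG' : M₁ ≤ ((ℓ : ℝ) + 1) * i.Mh := (le_max_right _ _).trans hM
  have hNP : NP + 1 ≤ (toKT i).R * ((ℓ + 1) * (toKT i).Mh) := le_trans (Nat.succ_le_succ (le_max_left _ _)) hN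
  have hN1 : N1 d ℓ (9 / 5000 * δ₂) + 1 ≤ (toKT i).R * ((ℓ + 1) * (toKT i).Mh) := le_trans (Nat.succ_le_succ (le_max_right _ _)) hN
  have hTP : TP ≤ RM1 i := (le_max_left _ _).trans hT
  have hT2 : 4 * Real.log ((ℓ : ℝ) + 1) / (9 / 5000 * δ₂) ≤ RM1 i := ((le_max_left _ _).trans (le_max_right _ _)).trans hT
  have hRM3 : 3 < RM1 i := lt_of_lt_of_le (by norm_num) (((le_max_right _ _).trans (le_max_right _ _)).trans hT)
  have hRM : 2 < RM1 i := lt_trans (by norm_num) hRM3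
  -- the size `α₁ = 2CΛ²` and the window size `α_T = alphaW(α₁)·L²`
  set α₁ : ℝ := 2 * C * Λ ^ 2 with hα₁def
  have hα₁0 : 0 ≤ α₁ := by rw [hα₁def]; positivity
  have hα₁P : α₁ ≤ aP := hα₁a.trans (min_le_left _ _)
  have hα₁L : α₁ ≤ 1 / (120 * ((ℓ : ℝ) + 1) ^ 2) := hα₁a.trans (min_le_right _ _)
  have hL2 : (1 : ℝ) ≤ ((ℓ : ℝ) + 1) ^ 2 := one_le_pow₀ hL1
  have hL20 : 0 < ((ℓ : ℝ) + 1) ^ 2 := by positivity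
  have hα₁6 : α₁ ≤ 1 / 6 := by
    refine hα₁L.trans (one_div_le_one_div_of_le (by norm_num) ?_)
    have h120 : (120 : ℝ) * 1 ≤ 120 * ((ℓ : ℝ) + 1) ^ 2 := mul_le_mul_of_nonneg_left hL2 (by norm_num)
    linarith
  have hα₁1 : α₁ ≤ 1 := hα₁6.trans (by norm_num)
  set αW : ℝ := alphaW α₁ * ((ℓ : ℝ) + 1) ^ 2 with hαWdef
  have hαW0 : 0 ≤ αW := by rw [hαWdef]; exact mul_nonneg (alphaW_nonneg hα₁0) (sq_nonneg _)
  have hαWα : α₁ ≤ αW := by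
    rw [hαWdef]
    calc α₁ ≤ alphaW α₁ := self_le_alphaW hα₁0
      _ = alphaW α₁ * 1 := (mul_one _).symm
      _ ≤ alphaW α₁ * ((ℓ : ℝ) + 1) ^ 2 := mul_le_mul_of_nonneg_left hL2 (alphaW_nonneg hα₁0)
  have hαW60 : αW ≤ 60 * ((ℓ : ℝ) + 1) ^ 2 * α₁ := by
    rw [hαWdef]; have h := alphaW_le_sixty_mul hα₁0 hα₁6; nlinarith [sq_nonneg ((ℓ : ℝ) + 1)]
  have hαW1 : αW ≤ 1 := by
    refine hαW60.trans ?_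
    have h1 : 60 * ((ℓ : ℝ) + 1) ^ 2 * α₁ ≤ 60 * ((ℓ : ℝ) + 1) ^ 2 * (1 / (120 * ((ℓ : ℝ) + 1) ^ 2)) :=
      mul_le_mul_of_nonneg_left hα₁L (by positivity)
    have h2 : 60 * ((ℓ : ℝ) + 1) ^ 2 * (1 / (120 * ((ℓ : ℝ) + 1) ^ 2)) = 1 / 2 := by
      rw [mul_one_div, div_eq_iff (by positivity)]; ring
    linarith
  -- geometry
  haveI : Nonempty (geoCK i c).Site := geoCK_site_nonempty i c
  obtain ⟨hdnn, htri, -, -⟩ := geoCK_dist_axioms i c Rr H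
  set η : ℝ := (kGeo i).eta with hηdef
  have hη : 0 < η := by rw [hηdef, ← geoCK_eta i c]; exact geoCK_eta_pos i c
  set S := dirDomY i c with hSdef
  set B := bondsOverY i (dirDomY i c) with hBdef
  set V := cutCfgS i T η A with hVdef
  have hlen0 : ∀ y : BlkCubeY i c, 0 ≤ (geoCK i c).len y := fun y => (geoCK_len_pos i c y).le
  have hS1 : ∀ z : SiteY i, 1 ≤ levCubeY i c z → z ∈ S := fun z hz => (hS2 z hz).1
  have hQS : ∀ z ∈ S, (boxEquiv i.hN).symm z ∈ Q := fun z hz => hQT z (hTS z hz)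
  have hS2T : ∀ z : SiteY i, 1 ≤ levCubeY i c z → z ∈ T ∧ ∀ μ, shiftY i μ z ∈ T ∧ (shiftY i μ).symm z ∈ T ∧
      ∀ ν, shiftY i ν (shiftY i μ z) ∈ T ∧ shiftY i ν ((shiftY i μ).symm z) ∈ T ∧ (shiftY i ν).symm ((shiftY i μ).symm z) ∈ T := fun z hz => by
    obtain ⟨h0, hμ⟩ := hS2 z hz
    exact ⟨hTS _ h0, fun μ => ⟨hTS _ (hμ μ).1, hTS _ (hμ μ).2.1, fun ν =>
      ⟨hTS _ ((hμ μ).2.2 ν).1, hTS _ ((hμ μ).2.2 ν).2.1, hTS _ ((hμ μ).2.2 ν).2.2⟩⟩⟩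
  -- the two fields agree on the bonds inside `Ω₀(□)`
  have hin : ∀ z ∈ S, ∀ μ : Fin (d + 1), shiftY i μ z ∈ S → UboxY i V μ z = UboxY i (cutCfgS i S η A) μ z := fun z hz μ hz' => by
    rw [hVdef, UboxY_cutCfgS, UboxY_cutCfgS, if_pos ⟨hTS z hz, hTS _ hz'⟩, if_pos ⟨hz, hz'⟩]
  -- (2.61) at `(δ₂, 9∕5000)` and the two inverse-power scale transfers
  have h261' : Ineq261 dB (toB6 (geoCK i c) Rr H) δ₂ (9 / 5000) := h261 i c Rr H hN1 (9 / 5000) le_rfl (by norm_num)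
  obtain ⟨-, -, hST3, hST4, -, -⟩ := hST_geoCK i c hδ₂ hT2 (9 / 5000) le_rfl
  -- R1 at the member: the flat entry and the RIGHT entry of `G_□(1)` (rate `δ₃`), weakened
  obtain ⟨gG, -, gGDs, -⟩ := h33 i c Rr H KB hKB hMG'
  have hGδ₁ : HasMajorant (g := toB6 (geoCK i c) Rr H) (blkBK i c) (GiK b i (TKnitCY i c (fun _ _ => 1)) B)
      (fun a a' => B₀ * (geoCK i c).len a ^ 2 * Real.exp (-(δ₁ * (geoCK i c).dist a a'))) :=
    hasMajorant_mono (g := toB6 (geoCK i c) Rr H) _ gG fun a a' => kernel_const_mono hdnn (fun a => (geoCK i c).len a ^ 2) (fun _ => sq_nonneg _) hARB hB₀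
      (hδ₁δ.trans hδG') a a'
  have hGDsδ : ∀ μ, HasMajorant (g := toB6 (geoCK i c) Rr H) (blkBK i c) (GiK b i (TKnitCY i c (fun _ _ => 1)) B * DsK b i μ)
      (fun a a' => AR * (geoCK i c).len a * Real.exp (-(δ * (geoCK i c).dist a a'))) := fun μ =>
    hasMajorant_mono (g := toB6 (geoCK i c) Rr H) _ (gGDs μ) fun a a' => kernel_rate_mono hdnn hδG' (mul_nonneg hAR.le (hlen0 a)) a a'
  -- p38 §2: the right flat entry `G_□(1)∇_μ` at the rate `δ₁`, constant weakened to `B₀`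
  have hGDδ₁ : ∀ μ, HasMajorant (g := toB6 (geoCK i c) Rr H) (blkBK i c) (GiK b i (TKnitCY i c (fun _ _ => 1)) B * DK b i μ)
      (fun a a' => B₀ * (geoCK i c).len a * Real.exp (-(δ₁ * (geoCK i c).dist a a'))) := fun μ => by
    have h := hasMajorant_mul_DK_of_DsK b i c Rr H dB (δ₀ := δ₂) (β := 9 / 5000) (ρ := δ₁) (r := δ) hAR.le hδ₁.le (by positivity)
      (by rw [hδ₁def, hδ₂def]; linarith only [hδ.le]) h261' μ (hGDsδ μ)
    exact hasMajorant_mono (g := toB6 (geoCK i c) Rr H) _ h fun a a' =>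
      kernel_const_mono hdnn (fun a => (geoCK i c).len a) hlen0 hAEB hB₀ le_rfl a a'
  -- F3: the windows of the sharp cut (constant `αW = alphaW(α₁)·L²`), radius 2
  have hW1 := hW1_cut i c hC hξ hΛ hΛξ hQT hA hdA hS2T hRM
  have hW2 := hW2_cut i c hC hξ hΛ hΛξ hQT hA hdA hS2T hRM
  have hW3 := hW3_cut i c hC hξ hΛ hΛξ hQT hA hdA hS2T hRM hU
  have hW3' : ∀ (a : BlkCubeY i c) (p : Node00.PlaqY i), dSite i c a p.src ≤ 2 →
      ‖Node00.reHolY i V p - 1‖ ≤ αW * ((kGeo i).eta * ((geoCK i c).len a)⁻¹) ^ 2 := fun a p hp => (hW3 a p hp).1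
  -- SLOT `V⁰`, `V¹_μ`, `P⁰`, `P¹_μ` at the windows, rate `δ₁`
  have hLap : lapPieceK b i V = conj b ((V0Y i V).restrictScalars ℝ) + ∑ μ, conj b ((V1Y i V μ).restrictScalars ℝ) * DK b i μ :=
    conj_hessY_one_sub_hessY_eq i b _
  have hV0 := hasMajorant_V0Y i c b hU hM₂ hrepr hαW0 hαW1 hW1 hW2 hW3 hδ₁.le Rr H
  have hV1 := fun ν => hasMajorant_V1Y i c b hU hM₂ hrepr hαW0 hW1 hW3' hδ₁.le Rr H ν
  have hP0 := hasMajorant_P0Y i c b hU hM₂ hrepr hαW0 hαW1 hW1 hW2 hδ₁.le Rr H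
  have hP1 := fun ν => hasMajorant_P1Y i c b hU hM₂ hrepr hαW0 hW1 hδ₁.le Rr H ν
  have hW0' : HasMajorant (g := toB6 (geoCK i c) Rr H) (blkBK i c) (conj b ((V0Y i V).restrictScalars ℝ) + conj b ((P0Y i V).restrictScalars ℝ))
      (fun a a' => (cV + cP) * αW * ((geoCK i c).len a ^ 2)⁻¹ * Real.exp (-(δ₁ * (geoCK i c).dist a a'))) := by
    refine hasMajorant_mono (g := toB6 (geoCK i c) Rr H) _ (hasMajorant_add (g := toB6 (geoCK i c) Rr H) _ hV0 hP0) fun a a' => ?_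
    have hw : 0 ≤ αW * ((geoCK i c).len a ^ 2)⁻¹ * Real.exp (-(δ₁ * (geoCK i c).dist a a')) := by positivity
    have hleV : (M₂ * ∑ j, ‖b j‖) * (cV0 d * Real.exp (2 * δ₁)) ≤ cV := by
      rw [hcVdef, mul_assoc (M₂ * ∑ j, ‖b j‖)]; exact mul_le_mul_of_nonneg_left (mul_le_mul_of_nonneg_right (le_max_left _ _) (Real.exp_pos _).le) hMS
    have hleP : (M₂ * ∑ j, ‖b j‖) * (cP0 d * Real.exp (2 * δ₁)) ≤ cP := by
      rw [hcPdef, mul_assoc (M₂ * ∑ j, ‖b j‖)]; exact mul_le_mul_of_nonneg_left (mul_le_mul_of_nonneg_right (le_max_left _ _) (Real.exp_pos _).le) hMS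
    calc (M₂ * ∑ j, ‖b j‖) * (cV0 d * Real.exp (2 * δ₁) * αW * ((geoCK i c).len a ^ 2)⁻¹ * Real.exp (-(δ₁ * (geoCK i c).dist a a'))) +
          (M₂ * ∑ j, ‖b j‖) * (cP0 d * Real.exp (2 * δ₁) * αW * ((geoCK i c).len a ^ 2)⁻¹ * Real.exp (-(δ₁ * (geoCK i c).dist a a')))
        = ((M₂ * ∑ j, ‖b j‖) * (cV0 d * Real.exp (2 * δ₁)) + (M₂ * ∑ j, ‖b j‖) * (cP0 d * Real.exp (2 * δ₁))) *
            (αW * ((geoCK i c).len a ^ 2)⁻¹ * Real.exp (-(δ₁ * (geoCK i c).dist a a'))) := by ring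
      _ ≤ (cV + cP) * (αW * ((geoCK i c).len a ^ 2)⁻¹ * Real.exp (-(δ₁ * (geoCK i c).dist a a'))) := mul_le_mul_of_nonneg_right (add_le_add hleV hleP) hw
      _ = (cV + cP) * αW * ((geoCK i c).len a ^ 2)⁻¹ * Real.exp (-(δ₁ * (geoCK i c).dist a a')) := by ring
  have hW1' : ∀ ν, HasMajorant (g := toB6 (geoCK i c) Rr H) (blkBK i c) (conj b ((V1Y i V ν).restrictScalars ℝ) + conj b ((P1Y i V ν).restrictScalars ℝ))
      (fun a a' => (cV + cP) * αW * ((geoCK i c).len a)⁻¹ * Real.exp (-(δ₁ * (geoCK i c).dist a a'))) := fun ν => by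
    refine hasMajorant_mono (g := toB6 (geoCK i c) Rr H) _ (hasMajorant_add (g := toB6 (geoCK i c) Rr H) _ (hV1 ν) (hP1 ν)) fun a a' => ?_
    have hl : 0 ≤ ((geoCK i c).len a)⁻¹ := inv_nonneg.2 (geoCK_len_pos i c a).le
    have hw : 0 ≤ αW * ((geoCK i c).len a)⁻¹ * Real.exp (-(δ₁ * (geoCK i c).dist a a')) := by positivity
    have hleV : (M₂ * ∑ j, ‖b j‖) * (cV1 d * Real.exp (2 * δ₁)) ≤ cV := by
      rw [hcVdef, mul_assoc (M₂ * ∑ j, ‖b j‖)]; exact mul_le_mul_of_nonneg_left (mul_le_mul_of_nonneg_right (le_max_right _ _) (Real.exp_pos _).le) hMS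
    have hleP : (M₂ * ∑ j, ‖b j‖) * (cP1 d * Real.exp (2 * δ₁)) ≤ cP := by
      rw [hcPdef, mul_assoc (M₂ * ∑ j, ‖b j‖)]; exact mul_le_mul_of_nonneg_left (mul_le_mul_of_nonneg_right (le_max_right _ _) (Real.exp_pos _).le) hMS
    calc (M₂ * ∑ j, ‖b j‖) * (cV1 d * Real.exp (2 * δ₁) * αW * ((geoCK i c).len a)⁻¹ * Real.exp (-(δ₁ * (geoCK i c).dist a a'))) +
          (M₂ * ∑ j, ‖b j‖) * (cP1 d * Real.exp (2 * δ₁) * αW * ((geoCK i c).len a)⁻¹ * Real.exp (-(δ₁ * (geoCK i c).dist a a')))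
        = ((M₂ * ∑ j, ‖b j‖) * (cV1 d * Real.exp (2 * δ₁)) + (M₂ * ∑ j, ‖b j‖) * (cP1 d * Real.exp (2 * δ₁))) *
            (αW * ((geoCK i c).len a)⁻¹ * Real.exp (-(δ₁ * (geoCK i c).dist a a'))) := by ring
      _ ≤ (cV + cP) * (αW * ((geoCK i c).len a)⁻¹ * Real.exp (-(δ₁ * (geoCK i c).dist a a'))) := mul_le_mul_of_nonneg_right (add_le_add hleV hleP) hw
      _ = (cV + cP) * αW * ((geoCK i c).len a)⁻¹ * Real.exp (-(δ₁ * (geoCK i c).dist a a')) := by ring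
  -- SLOT `PP`: ROAD (I)'s (3.77) at the field cut AT `Ω₀`, compressed (F2a) — the same compression as at `V` (F2b); rate weakened `δ_P → δ₁`
  obtain ⟨-, hPPS⟩ := HCP i c Rr H hMP hNP hTP A Q C ξ Λ α₀' hC hξ hΛ hΛξ hQS hA hdA hS2 hα₁P hα' hα3 hα4' hsmall hc₃ hsm
  have hPP : HasMajorant (g := toB6 (geoCK i c) Rr H) (blkBK i c)
      (projK b i B * conj b ((gradY i (cutCfgS i S η A) ∘ₗ PDirCubeY i c S (cutCfgS i S η A) ∘ₗ divY i (cutCfgS i S η A) -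
        gradY i (fun _ _ => 1) ∘ₗ PDirCubeY i c S (fun _ _ => 1) ∘ₗ divY i (fun _ _ => 1)).restrictScalars ℝ) * projK b i B)
      (fun a a' => K * αW * ((geoCK i c).len a ^ 2)⁻¹ * Real.exp (-(δ₁ * (geoCK i c).dist a a'))) := by
    refine hasMajorant_mono (g := toB6 (geoCK i c) Rr H) _ (hasMajorant_projK_mul_mul_projK b i c B Rr H hPPS) fun a a' => ?_
    calc K * (2 * C * Λ ^ 2) * ((geoCK i c).len a ^ 2)⁻¹ * Real.exp (-(δP * (geoCK i c).dist a a'))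
        = (K * α₁) * ((geoCK i c).len a ^ 2)⁻¹ * Real.exp (-(δP * (geoCK i c).dist a a')) := by rw [hα₁def]
      _ ≤ (K * αW) * ((geoCK i c).len a ^ 2)⁻¹ * Real.exp (-(δ₁ * (geoCK i c).dist a a')) :=
          kernel_const_mono hdnn (fun a => ((geoCK i c).len a ^ 2)⁻¹) (fun a => by positivity) (mul_le_mul_of_nonneg_left hαWα hK)
            (mul_nonneg hK hαW0) (hδ₁δ.trans hδP') a a'
      _ = K * αW * ((geoCK i c).len a ^ 2)⁻¹ * Real.exp (-(δ₁ * (geoCK i c).dist a a')) := by ring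
  -- SLOT `AV`: dag-n06-j's knit averaging piece at `a := Ã`, rate `δ₁`
  have hVfl : ∀ μ x, V μ x = fluct (kGeo i).eta (cutFldS i T A) μ x := fun μ x => by
    rw [hVdef]; show fluct (kGeo i).eta (cutFldS i T A) μ x * 1 = _; rw [mul_one]
  have hAv0 := hasMajorant_avgPieceCKnit b i c hα₀ hMα hα' hα3 hα8 hKpl hϱ' hϱ hsmall' hc₃' hϱ'1 hE hdX hsmallJ hc₃J hM₂ hrepr hb₀ hb₁ (cutFldS i T A) hα₁0
    hα₁ϱ (ha_cut i c hC hΛ hΛξ hQT hA) V hVfl hδ₁.le Rr H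
  have hAv : HasMajorant (g := toB6 (geoCK i c) Rr H) (blkBK i c) (avgPieceCKnit b i c V)
      (fun a a' => κ₂ * αW * ((geoCK i c).len a ^ 2)⁻¹ * Real.exp (-(δ₁ * (geoCK i c).dist a a'))) := by
    refine hasMajorant_mono (g := toB6 (geoCK i c) Rr H) _ hAv0 fun a a' => ?_
    have hw : 0 ≤ ((geoCK i c).len a ^ 2)⁻¹ * Real.exp (-(δ₁ * (geoCK i c).dist a a')) := by positivity
    have hk : (M₂ * ∑ j, ‖b j‖) * kappaAvKnit d ℓ N b₁ ϱ' α₁ δ₁ * α₁ ≤ κ₂ * αW := by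
      rw [hκ₂def]
      exact mul_le_mul (mul_le_mul_of_nonneg_left (kappaAvKnit_mono hb₁0 hϱ' hα₁1) hMS) hαWα hα₁0
        (mul_nonneg hMS (kappaAvKnit_nonneg hb₁0 hϱ' zero_le_one))
    calc (M₂ * ∑ j, ‖b j‖) * kappaAvKnit d ℓ N b₁ ϱ' α₁ δ₁ * α₁ * ((geoCK i c).len a ^ 2)⁻¹ * Real.exp (-(δ₁ * (geoCK i c).dist a a'))
        = ((M₂ * ∑ j, ‖b j‖) * kappaAvKnit d ℓ N b₁ ϱ' α₁ δ₁ * α₁) * (((geoCK i c).len a ^ 2)⁻¹ * Real.exp (-(δ₁ * (geoCK i c).dist a a'))) := by ring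
      _ ≤ (κ₂ * αW) * (((geoCK i c).len a ^ 2)⁻¹ * Real.exp (-(δ₁ * (geoCK i c).dist a a'))) := mul_le_mul_of_nonneg_right hk hw
      _ = κ₂ * αW * ((geoCK i c).len a ^ 2)⁻¹ * Real.exp (-(δ₁ * (geoCK i c).dist a a')) := by ring
  -- SLOT commutators: R2 (G-F8a at the radius-3 windows of the sharp cut), rate `δ₁`
  have hCV := fun μ => hasMajorant_commV1Y_cutCfgS i c hC hξ hΛ hΛξ hQT hA hdA hS2T hRM3 b hM₂ hrepr hU (by rw [← hα₁def, ← hαWdef]; exact hαW1) hδ₁.le Rr H μ μ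
  have hCP := fun μ => hasMajorant_commP1Y_cutCfgS i c hC hξ hΛ hΛξ hQT hA hdA hS2T hRM3 b hM₂ hrepr hU hδ₁.le Rr H μ μ
  have hCk : ∀ μ, HasMajorant (g := toB6 (geoCK i c) Rr H) (blkBK i c)
      ((conj b ((V1Y i V μ).restrictScalars ℝ) + conj b ((P1Y i V μ).restrictScalars ℝ)) * DK b i μ -
        DK b i μ * (conj b ((V1Y i V μ).restrictScalars ℝ) + conj b ((P1Y i V μ).restrictScalars ℝ)))
      (fun a a' => cKc * αW * ((geoCK i c).len a ^ 2)⁻¹ * Real.exp (-(δ₁ * (geoCK i c).dist a a'))) := fun μ => by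
    rw [add_mul_sub_mul_add]
    refine hasMajorant_mono (g := toB6 (geoCK i c) Rr H) _ (hasMajorant_add (g := toB6 (geoCK i c) Rr H) _ (hCV μ) (hCP μ)) fun a a' => le_of_eq ?_
    rw [hcKcdef, hαWdef, hα₁def]; ring
  -- the zeroth-order part `Z` and the first-order coefficients `W_μ`
  have hZ : HasMajorant (g := toB6 (geoCK i c) Rr H) (blkBK i c)
      (conj b ((V0Y i V).restrictScalars ℝ) + conj b ((P0Y i V).restrictScalars ℝ) +
        projK b i B * conj b ((gradY i (cutCfgS i S η A) ∘ₗ PDirCubeY i c S (cutCfgS i S η A) ∘ₗ divY i (cutCfgS i S η A) -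
          gradY i (fun _ _ => 1) ∘ₗ PDirCubeY i c S (fun _ _ => 1) ∘ₗ divY i (fun _ _ => 1)).restrictScalars ℝ) * projK b i B +
        avgPieceCKnit b i c V)
      (fun a a' => cZ * αW * ((geoCK i c).len a ^ 2)⁻¹ * Real.exp (-(δ₁ * (geoCK i c).dist a a'))) := by
    refine hasMajorant_mono (g := toB6 (geoCK i c) Rr H) _
      (hasMajorant_add (g := toB6 (geoCK i c) Rr H) _ (hasMajorant_add (g := toB6 (geoCK i c) Rr H) _ hW0' hPP) hAv) fun a a' => le_of_eq ?_
    rw [hcZdef]; ring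
  -- p38 §1 at the Dirichlet letter: `G_□(1)·(Z + Σ_μ W_μ∇_μ) ≺ κ_R·α_T·e^{−δ₂d}`
  have hGV := hasMajorant_GV_of_gradForm_comm_dirs (R := Rr) (H := H) (blkBK i c) dB δ₂ δ₁ (9 / 5000) (9 / 5000) δ₂ Λ4 B₀ cZ (cV + cP) cKc αW
    hB₀ hcZ (add_nonneg hcV hcP) hcKc hαW0 hΛ4 hδ₂.le (by norm_num) (by norm_num) hδ₂.le (by rw [hδ₁def, hδ₂def]; linarith only [hδ.le]) hdnn htri (geoCK_len_pos i c)
    h261' hST3 hST4 hZ hW1' hCk hGδ₁ hGDδ₁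
  -- F4's (3.84) split at the knit pair, regrouped, and COMPRESSED with the `Ω₀`-cut projection word (F2b)
  have hX : conj b ((TKnitCY i c (fun _ _ => 1) - TKnitCY i c V).restrictScalars ℝ) =
      lapPieceK b i V + projPieceDirK b i c S V + avgPieceCKnit b i c V := by
    rw [TKnitCY_apply, TKnitCY_apply]; exact dirB_split_CK b i c S V
  have hProj := projPieceDirK_eq_firstOrder_add_projWord b i c S V
  have hsplit : conj b ((TKnitCY i c (fun _ _ => 1) - TKnitCY i c V).restrictScalars ℝ) =
      (conj b ((V0Y i V).restrictScalars ℝ) + conj b ((P0Y i V).restrictScalars ℝ)) +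
        ∑ ν, (conj b ((V1Y i V ν).restrictScalars ℝ) + conj b ((P1Y i V ν).restrictScalars ℝ)) * DK b i ν +
        conj b ((gradY i V ∘ₗ PDirCubeY i c S V ∘ₗ divY i V - gradY i (fun _ _ => 1) ∘ₗ PDirCubeY i c S (fun _ _ => 1) ∘ₗ divY i (fun _ _ => 1)).restrictScalars ℝ) +
        avgPieceCKnit b i c V := by
    rw [hX, hLap, hProj]
    simp only [add_mul, Finset.sum_add_distrib]
    abel
  have hcongr := projK_projWordDir_projK_congr_of_inside i c S hin hS1 b
  have hsplitC := splitC_of_split_of_congr b i (B := B) hsplit hcongr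
  -- §1: `G_□(1)·V_□ = (G_□(1)·(Z + Σ_μW_μ∇_μ))·𝟙♯`, and the right compression is free (F2a)
  have hEq := GiK_mul_VdK_eq_of_splitC b i V hsplitC
  have ePieces : (conj b ((V0Y i V).restrictScalars ℝ) + conj b ((P0Y i V).restrictScalars ℝ)) +
        ∑ ν, (conj b ((V1Y i V ν).restrictScalars ℝ) + conj b ((P1Y i V ν).restrictScalars ℝ)) * DK b i ν +
        projK b i B * conj b ((gradY i (cutCfgS i S η A) ∘ₗ PDirCubeY i c S (cutCfgS i S η A) ∘ₗ divY i (cutCfgS i S η A) -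
          gradY i (fun _ _ => 1) ∘ₗ PDirCubeY i c S (fun _ _ => 1) ∘ₗ divY i (fun _ _ => 1)).restrictScalars ℝ) * projK b i B +
        avgPieceCKnit b i c V =
      (conj b ((V0Y i V).restrictScalars ℝ) + conj b ((P0Y i V).restrictScalars ℝ) +
        projK b i B * conj b ((gradY i (cutCfgS i S η A) ∘ₗ PDirCubeY i c S (cutCfgS i S η A) ∘ₗ divY i (cutCfgS i S η A) -
          gradY i (fun _ _ => 1) ∘ₗ PDirCubeY i c S (fun _ _ => 1) ∘ₗ divY i (fun _ _ => 1)).restrictScalars ℝ) * projK b i B +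
        avgPieceCKnit b i c V) +
      ∑ ν, (conj b ((V1Y i V ν).restrictScalars ℝ) + conj b ((P1Y i V ν).restrictScalars ℝ)) * DK b i ν := by
    abel
  rw [hEq, ePieces]
  refine hasMajorant_mono (g := toB6 (geoCK i c) Rr H) _ (hasMajorant_mul_projK b i c B Rr H hGV) fun a a' => ?_
  have hw : 0 ≤ Real.exp (-(δ₂ * (geoCK i c).dist a a')) := (Real.exp_pos _).le
  have hcoef : B₀ * Λ4 * B6.c1 dB δ₂ (9 / 5000) * ((Fintype.card (Fin (d + 1)) : ℝ) * (cV + cP) + (cZ + (Fintype.card (Fin (d + 1)) : ℝ) * cKc)) = κR := by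
    rw [hκRdef]
    simp only [Fintype.card_fin, Nat.cast_add, Nat.cast_one]
    ring
  rw [hcoef]
  calc κR * αW * Real.exp (-(δ₂ * (geoCK i c).dist a a')) ≤ κR * (60 * ((ℓ : ℝ) + 1) ^ 2 * α₁) * Real.exp (-(δ₂ * (geoCK i c).dist a a')) :=
        mul_le_mul_of_nonneg_right (mul_le_mul_of_nonneg_left hαW60 hκR) hw
    _ = 60 * ((ℓ : ℝ) + 1) ^ 2 * κR * (2 * C * Λ ^ 2) * Real.exp (-(δ₂ * (geoCK i c).dist a a')) := by rw [hα₁def]; ring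

end Main

end Literature.MathematicalPhysics.QuantumFieldTheory.Balaban1983to89.B9Cor36GDirKnitGVDivFormAtCutField

end
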